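import Mathlib.RingTheory.Localization.FractionRing
import Mathlib.RingTheory.Localization.Integer
import Mathlib.Algebra.Polynomial.Div
import Mathlib.Algebra.Polynomial.Degree.TrailingDegree
import Literature.Computability.AlgebraicComplexity.MatMulRankLowerBoundsProofs
import Literature.Computability.AlgebraicComplexity.SchoenhageTau
import HarnessLib

/-!
# The Koszul flattening lower bound for BORDER rank — proved

Topic `Literature/Computability/AlgebraicComplexity`.  Step 2 of the provefact decomposition of
`CGLV2022_thm12` (`BorderRankCW.lean`): the inequality behind every lower bound of Conner–Gesmundo–
Landsberg–Ventura 2022, §3,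

  `C(2p, p) · R̲(t) ≥ rank K_Φ(t)`   (`t ∈ K^ι ⊗ K^κ ⊗ K^μ`, `Φ : K^ι → K^{2p+1}`, any field `K`)

(Landsberg–Ottaviani 2013, Prop. 4.1.1 / 2015, Thm. 2.1, quoted as CGLV 2022, §3, eq. (8):
`R̲(T) ≥ rank(T_A^{∧p}) / C(dim A - 1, p)`, "in practice … the denominator is replaced by `C(2p,p)`"),
for the tree's ALGEBRAIC border rank `algBorderRank` over `K[ε]` (`SchoenhageTau.lean`, Bläser 2013,
Def. 6.1) and the tree's coordinate Koszul flattening `koszulFlattening p Φ t`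
(`MatMulRankLowerBoundsProofs.lean`, where the RANK version `rank K_Φ(t) ≤ C(2p,p) R(t)` is
`LandsbergOttaviani2015_rank_koszulFlattening_le`).  Everything here is PROVED; no definitions.
The projection `Φ` is taken in matrix form `Φ = M.mulVecLin`, so that it can be base-changed.

## The proof (semicontinuity, made algebraic)

Let `r = R̲(t)`, attained by an order-`h` approximate decomposition `T = ∑_{ρ<r} u_ρ ⊗ v_ρ ⊗ w_ρ`
over `K[ε]`, so `T = εʰ (t + ε T')` entrywise, and by linearity `K_Φ(T) = εʰ (K_Φ(t) + ε K_Φ(T'))`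
(`koszulFlattening_mulVecLin_map`, `koszulFlattening_smul`).  Over the fraction field `L = K(ε)`,
`rank_L K_Φ(T) ≤ C(2p,p) · r` by the rank-one bound (`rank_koszulFlattening_sum_triad_le`).  It
remains to see `rank_K M₀ ≤ rank_L εʰ(M₀ + ε M₁)` (`rank_le_rank_map_of_perturbation`): take a
maximal set `s` of `K`-independent columns of `M₀` (`|s| = rank M₀`); were the same columns of
`εʰ(M₀ + εM₁)` `L`-dependent, clearing denominators gives polynomials `f_x`, not all `0`, with
`∑ f_x · col_x = 0`, and the coefficient of `ε^{d+h}`, `d` the least trailing degree of the nonzero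
`f_x`, is a nontrivial `K`-relation `∑ f_x[d] · M₀.col_x = 0` — a contradiction.

## References

* J. M. Landsberg, G. Ottaviani, *Equations for secant varieties of Veronese and other varieties*,
  Ann. Mat. Pura Appl. (4) 192 (2013) 569–606, Prop. 4.1.1 — cited through CGLV 2022, §3, eq. (8);
  *New lower bounds for the border rank of matrix multiplication*, Theory of Computing 11 (2015),
  Thm. 2.1. [LandsbergOttaviani2015]
* A. Conner, F. Gesmundo, J. M. Landsberg, E. Ventura, comput. complexity 31 (2022) =
  arXiv:1909.04785v2, §3 (first two paragraphs, eq. (8)). [ConnerGesmundoLandsbergVentura2022]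
-/

noncomputable section

open scoped BigOperators Polynomial
open Matrix Polynomial

namespace Literature.Computability.AlgebraicComplexity

universe u v₀ v₁ v₂

/-! ## Generic perturbations do not lower the rank below the special fibre -/

section Perturbation

variable {K : Type u} [Field K] {m : Type v₁} {m' : Type v₂} [Fintype m] [Fintype m']

/-- In degree `d` below the trailing degrees of `f`, the product `f · (a + ε P)` has coefficient
`f[d] · a`. [folklore] -/
theorem coeff_mul_C_add_X_mul {f P : K[X]} {a : K} {d : ℕ} (hf : ∀ e < d, f.coeff e = 0) :
    (f * (C a + X * P)).coeff d = f.coeff d * a := by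
  rw [mul_add, coeff_add, coeff_mul_C, show f * (X * P) = X * (f * P) by ring]
  cases d with
  | zero => simp
  | succ d =>
    rw [coeff_X_mul, coeff_mul, Finset.sum_eq_zero, add_zero]
    intro x hx
    rw [Finset.mem_antidiagonal] at hx
    rw [hf x.1 (by omega), zero_mul]

/-- **Semicontinuity of rank, algebraic form.** Let `M₀` be a matrix over the field `K`, `M₁` a
matrix over `K[ε]`, and `N = εʰ (M₀ + ε M₁)`.  Then `rank_K M₀ ≤ rank_{K(ε)} N` (rank over the
fraction field `L` of `K[ε]`). [folklore] -/
theorem rank_le_rank_map_of_perturbation {L : Type*} [Field L] [Algebra K[X] L]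
    [IsFractionRing K[X] L] (M₀ : Matrix m m' K) (M₁ N : Matrix m m' K[X]) (h : ℕ)
    (hN : ∀ i j, N i j = (C (M₀ i j) + X * M₁ i j) * X ^ h) :
    M₀.rank ≤ (N.map (algebraMap K[X] L)).rank := by
  classical
  obtain ⟨s, hli, hmax⟩ := exists_maximal_linearIndepOn K M₀.col
  -- (1) `rank M₀ ≤ |s|`
  have h1 : M₀.rank ≤ Fintype.card s := by
    rw [Matrix.rank_eq_finrank_span_cols]
    have hspan : Submodule.span K (Set.range M₀.col) ≤ Submodule.span K (M₀.col '' s) := by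
      rw [Submodule.span_le]
      rintro _ ⟨j, rfl⟩
      by_cases hj : j ∈ s
      · exact Submodule.subset_span ⟨j, hj, rfl⟩
      · obtain ⟨a, ha, hmem⟩ := hmax j hj
        have e : M₀.col j = a⁻¹ • (a • M₀.col j) := by rw [smul_smul, inv_mul_cancel₀ ha, one_smul]
        rw [e]
        exact Submodule.smul_mem _ _ hmem
    refine (Submodule.finrank_mono hspan).trans_eq ?_
    rw [Set.image_eq_range]
    exact finrank_span_eq_card hli
  -- (2) the same columns of `N` are independent over `L`
  set NL := N.map (algebraMap K[X] L) with hNL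
  have h2 : LinearIndependent L (fun x : s => NL.col x) := by
    rw [Fintype.linearIndependent_iff]
    intro g hg
    -- clear denominators: `f x = b • g x` with `f x ∈ K[X]`
    obtain ⟨b, hb⟩ := IsLocalization.exist_integer_multiples (nonZeroDivisors K[X]) Finset.univ g
    choose f hf using fun x => hb x (Finset.mem_univ x)
    have hb0 : algebraMap K[X] L (b : K[X]) ≠ 0 :=
      IsFractionRing.to_map_ne_zero_of_mem_nonZeroDivisors b.2
    -- the polynomial relation `∑ f x · N.col x = 0`
    have hrel : ∀ i, ∑ x : s, f x * N i x = 0 := by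
      intro i
      apply IsFractionRing.injective K[X] L
      have hi := congr_fun hg i
      rw [Finset.sum_apply, Pi.zero_apply] at hi
      rw [map_sum, map_zero]
      calc ∑ x : s, algebraMap K[X] L (f x * N i x)
          = ∑ x : s, algebraMap K[X] L (b : K[X]) * (g x • NL.col x) i := by
            refine Finset.sum_congr rfl fun x _ => ?_
            rw [map_mul, hf x, Pi.smul_apply, smul_eq_mul, Matrix.col_apply, hNL, Matrix.map_apply,
              Algebra.smul_def, mul_assoc]
        _ = 0 := by rw [← Finset.mul_sum, hi, mul_zero]
    -- it suffices that all `f x` vanish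
    suffices hf0 : ∀ x, f x = 0 by
      intro x
      have hx := hf x
      rw [hf0 x, map_zero, Algebra.smul_def] at hx
      exact (mul_eq_zero.1 hx.symm).resolve_left hb0
    by_contra hne
    push Not at hne
    obtain ⟨x₀, hx₀⟩ := hne
    -- among the nonzero `f x`, one of least trailing degree
    obtain ⟨x₁, hx₁, hmin⟩ := Finset.exists_min_image (Finset.univ.filter fun x => f x ≠ 0)
      (fun x => (f x).natTrailingDegree) ⟨x₀, by simpa using hx₀⟩
    rw [Finset.mem_filter] at hx₁
    set d := (f x₁).natTrailingDegree with hd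
    have hlow : ∀ x, ∀ e < d, (f x).coeff e = 0 := by
      intro x e he
      by_cases hx : f x = 0
      · rw [hx, coeff_zero]
      · exact coeff_eq_zero_of_lt_natTrailingDegree (he.trans_le (hmin x (by simpa using hx)))
    -- the coefficient of `ε^{d+h}` of the relation is a `K`-relation among the columns of `M₀`
    have hK : ∑ x : s, (f x).coeff d • M₀.col x = 0 := by
      funext i
      rw [Finset.sum_apply, Pi.zero_apply]
      have := congrArg (fun P : K[X] => P.coeff (d + h)) (hrel i)
      simp only [finsetSum_coeff, coeff_zero] at this
      rw [← this]
      refine Finset.sum_congr rfl fun x _ => ?_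
      rw [Pi.smul_apply, smul_eq_mul, Matrix.col_apply, hN, ← mul_assoc, coeff_mul_X_pow,
        coeff_mul_C_add_X_mul (hlow x)]
    have hcoeff := (Fintype.linearIndependent_iff.1 hli _ hK) x₁
    have : (f x₁).trailingCoeff = 0 := hcoeff
    exact hx₁.2 (trailingCoeff_eq_zero.1 this)
  -- (3) hence `|s| ≤ rank_L N`
  have h3 : Fintype.card s ≤ NL.rank := by
    rw [Matrix.rank_eq_finrank_span_cols]
    have hli' : LinearIndependent L (fun x : s => (⟨NL.col x, Submodule.subset_span ⟨_, rfl⟩⟩ :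
        Submodule.span L (Set.range NL.col))) :=
      LinearIndependent.of_comp (Submodule.span L (Set.range NL.col)).subtype h2
    exact hli'.fintype_card_le_finrank
  exact h1.trans h3

end Perturbation

/-! ## Base change and scalars for the coordinate Koszul flattening -/

section KoszulCalculus

variable {R : Type u} [CommRing R] {ι : Type v₀} {κ : Type v₁} {μ : Type v₂}

/-- **Base change**: for `Φ = M.mulVecLin` given by a matrix, applying a ring homomorphism `f`
entrywise commutes with the Koszul flattening (`Φ ↦ M.map f`, `t ↦ f ∘ t`). [folklore] -/
theorem koszulFlattening_mulVecLin_map [Fintype ι] {S : Type*} [CommRing S] (f : R →+* S) (p : ℕ)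
    (M : Matrix (Fin (2 * p + 1)) ι R) (t : ι → κ → μ → R) :
    (koszulFlattening p M.mulVecLin t).map f =
      koszulFlattening p (M.map f).mulVecLin (fun a b c => f (t a b c)) := by
  ext r c
  simp only [Matrix.map_apply, koszulFlattening_apply, wedgeMatrix_apply, Matrix.mulVecLin_apply,
    map_sum]
  refine Finset.sum_congr rfl fun j _ => ?_
  split_ifs
  · rw [map_mul, map_intCast, RingHom.map_mulVec]
    rfl
  · rw [map_zero]

/-- `t ↦ K_Φ(t)` is homogeneous: `K_Φ(x • t) = x • K_Φ(t)`. [folklore] -/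
theorem koszulFlattening_smul (p : ℕ) (Φ : (ι → R) →ₗ[R] (Fin (2 * p + 1) → R)) (x : R)
    (t : ι → κ → μ → R) : koszulFlattening p Φ (x • t) = x • koszulFlattening p Φ t := by
  ext r c
  simp only [koszulFlattening_apply, Matrix.smul_apply, smul_eq_mul]
  rw [show (fun a => (x • t) a c.2 r.2) = x • fun a => t a c.2 r.2 from rfl, map_smul,
    wedgeMatrix_smul, Matrix.smul_apply, smul_eq_mul]

end KoszulCalculus

/-! ## The border rank bound -/

section BorderRank

variable {K : Type u} [Field K] {ι : Type v₀} {κ : Type v₁} {μ : Type v₂}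
variable [Fintype ι] [Fintype κ] [Fintype μ]

/-- **The Koszul flattening lower bound for border rank** (Landsberg–Ottaviani 2013, Prop. 4.1.1 /
2015, Thm. 2.1; CGLV 2022, §3, eq. (8)): for every tensor `t ∈ K^ι ⊗ K^κ ⊗ K^μ` over a field, every
`p` and every `M : K^ι → K^{2p+1}`, `rank K_M(t) ≤ C(2p, p) · R̲(t)`, i.e.
`R̲(t) ≥ rank((M t)_A^{∧p}) / C(2p, p)`, for the algebraic border rank over `K[ε]`.
[cite: ConnerGesmundoLandsbergVentura2022, §3 eq. (8)] -/
theorem rank_koszulFlattening_le_choose_mul_algBorderRank [DecidableEq ι] [DecidableEq κ]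
    [DecidableEq μ] (p : ℕ) (M : Matrix (Fin (2 * p + 1)) ι K) (t : ι → κ → μ → K) :
    (koszulFlattening p M.mulVecLin t).rank ≤ (2 * p).choose p * algBorderRank t := by
  classical
  -- the border rank is attained at some order `h`, by a decomposition with `r` triads
  obtain ⟨h, hh⟩ : ∃ h, approxRank h t = algBorderRank t := by
    obtain ⟨h, hh⟩ := Nat.sInf_mem (Set.range_nonempty fun h : ℕ => approxRank h t)
    exact ⟨h, hh⟩
  obtain ⟨u, v, w, huvw⟩ := Nat.sInf_mem (exists_isApproxDecomposition h t)
  set r := approxRank h t with hr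
  -- the polynomial tensor `T = ∑ u ⊗ v ⊗ w = εʰ (t + ε T')`
  set T : ι → κ → μ → K[X] := ∑ ρ, triad (u ρ) (v ρ) (w ρ) with hTdef
  have hT : ∀ a b c, ∀ j ≤ h, (T a b c).coeff j = if j = h then t a b c else 0 := by
    intro a b c j hj
    rw [← huvw a b c j hj, hTdef]
    simp only [Finset.sum_apply, triad_apply]
  have hdvd : ∀ a b c, X ^ (h + 1) ∣ T a b c - C (t a b c) * X ^ h := by
    intro a b c
    rw [X_pow_dvd_iff]
    intro d hd
    rw [coeff_sub, coeff_C_mul_X_pow, hT a b c d (by omega)]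
    split_ifs <;> simp
  choose T' hT' using hdvd
  have hTe : T = (X : K[X]) ^ h • ((fun a b c => C (t a b c)) + (X : K[X]) • T') := by
    funext a b c
    simp only [Pi.smul_apply, Pi.add_apply, smul_eq_mul]
    linear_combination hT' a b c
  -- linearity of the flattening: `K(T) = εʰ (K(t) + ε K(T'))`
  have hKF : koszulFlattening p (M.map (C : K →+* K[X])).mulVecLin T =
      (X : K[X]) ^ h • ((koszulFlattening p M.mulVecLin t).map (C : K →+* K[X]) +
        (X : K[X]) • koszulFlattening p (M.map (C : K →+* K[X])).mulVecLin T') := by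
    rw [hTe, koszulFlattening_smul, koszulFlattening_add, koszulFlattening_smul,
      koszulFlattening_mulVecLin_map]
  have hN : ∀ i j, koszulFlattening p (M.map (C : K →+* K[X])).mulVecLin T i j =
      (C (koszulFlattening p M.mulVecLin t i j) +
        X * koszulFlattening p (M.map (C : K →+* K[X])).mulVecLin T' i j) * X ^ h := by
    intro i j
    rw [hKF]
    simp only [Matrix.smul_apply, Matrix.add_apply, Matrix.map_apply, smul_eq_mul]
    ring
  -- over the fraction field `L = K(ε)`
  let L := FractionRing K[X]
  have key := rank_le_rank_map_of_perturbation (L := L) (koszulFlattening p M.mulVecLin t)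
    (koszulFlattening p (M.map (C : K →+* K[X])).mulVecLin T')
    (koszulFlattening p (M.map (C : K →+* K[X])).mulVecLin T) h hN
  have hmapT : (fun a b c => algebraMap K[X] L (T a b c)) =
      ∑ ρ, triad (fun a => algebraMap K[X] L (u ρ a)) (fun b => algebraMap K[X] L (v ρ b))
        (fun c => algebraMap K[X] L (w ρ c)) := by
    funext a b c
    simp only [hTdef, Finset.sum_apply, triad_apply, map_sum, map_mul]
  have hbound : ((koszulFlattening p (M.map (C : K →+* K[X])).mulVecLin T).map
      (algebraMap K[X] L)).rank ≤ (2 * p).choose p * r := by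
    rw [koszulFlattening_mulVecLin_map, hmapT]
    exact rank_koszulFlattening_sum_triad_le p _ _ _ _
  rw [← hh]
  exact key.trans hbound

/-- The bound in the form in which it is used (`R̲(t) ≥ ⌈rank / C(2p,p)⌉`): if
`rank K_M(t) > C(2p, p) · (R - 1)` then `R ≤ R̲(t)`. [cite: ConnerGesmundoLandsbergVentura2022, §3 eq. (8)] -/
theorem le_algBorderRank_of_lt_rank_koszulFlattening [DecidableEq ι] [DecidableEq κ] [DecidableEq μ]
    (p : ℕ) (M : Matrix (Fin (2 * p + 1)) ι K) (t : ι → κ → μ → K) {R : ℕ}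
    (hR : (2 * p).choose p * (R - 1) < (koszulFlattening p M.mulVecLin t).rank) :
    R ≤ algBorderRank t := by
  have h := rank_koszulFlattening_le_choose_mul_algBorderRank p M t
  have := Nat.lt_of_mul_lt_mul_left (hR.trans_le h)
  omega

end BorderRank

end Literature.Computability.AlgebraicComplexity

end
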